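import Literature.AlgebraicGeometry.Frobenioids.BirationalizationIsos
import HarnessLib

/-!
# Frobenioids I, Theorem 5.2 (iv), proof step: `F_P`-paths and the conjugated birational morphism

Mochizuki, *The geometry of Frobenioids I: the general theory*, Kyushu J. Math. **62** (2008)
293–400, §5, proof of Theorem 5.2 (iv), kurims text pp. 101–102 [cite: MochizukiFrdI2008, Thm.
5.2(iv) p.101]:
"If `C ∈ Ob(C)`, then let us refer to a(n) [ordered] pair of pre-steps in `C` `(B → A, A → C)` [sic;
`(ζ_A : B → A, ζ_C : B → C)`] such that `A ∈ Ob(P)` as an `F_P`-path for `C`. … we may associate to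
any morphism `φ : C → C'` … `{ζ^birat_{A'} ∘ (ζ^birat_{C'})⁻¹ ∘ φ^birat ∘ ζ^birat_C ∘
(ζ^birat_A)⁻¹}`
… [where the superscript 'birat's denote the images … in `C^birat`]".

This file defines `F_P`-paths (with co-angular pre-steps, so that their images in `C^birat` are
isomorphisms, Prop. 4.4 (iv) / `BirationalizationIsos.lean`) and the conjugated birational morphism
`pathHom φ : A^birat → A'^birat`, and proves that `φ ↦ pathHom φ` is functorial (identity and
composition) — i.e. defines the functor `C′ → C^birat` on the category `C′` of objects equipped
with an
`F_P`-path used in the proof of Thm. 5.2 (iv).  The `O^×`-component of `pathHom φ` (Remark 2.7.2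
factorisation inside `E ⊆ C^birat`) is not treated here.
-/

namespace Literature.AlgebraicGeometry.Frobenioids

open CategoryTheory Opposite

universe w v v' u u'

namespace PreFrobenioid

variable {D : Type u} [Category.{v} D] {Φ : Dᵒᵖ ⥤ CommMonCat.{w}}
  {C : Type u'} [Category.{v'} C]

variable (F : C ⥤ ElemFrobenioid Φ) in
/-- An **`F_P`-path** for an object `X` (proof of Thm. 5.2 (iv), p. 101): co-angular pre-steps
`ζ_A : B → A`, `ζ_X : B → X` with `A` in the distinguished class `P` (the objects of the base
category
of a base-Frobenius pair). [cite: MochizukiFrdI2008, Thm. 5.2(iv) p.101] -/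
structure FPPath (P : Set C) (X : C) : Type (max u' v') where
  /-- the `P`-object `A` -/
  A : C
  /-- the common source `B` -/
  B : C
  /-- `ζ_A : B → A` -/
  ζA : B ⟶ A
  /-- `ζ_X : B → X` -/
  ζX : B ⟶ X
  /-- `A ∈ Ob(P)` -/
  mem : A ∈ P
  /-- `ζ_A` is a co-angular pre-step -/
  ζA_mem : IsCoAngularPreStep F ζA
  /-- `ζ_X` is a co-angular pre-step -/
  ζX_mem : IsCoAngularPreStep F ζX

namespace FPPath

variable {F : C ⥤ ElemFrobenioid Φ} {hF : IsFrobenioid F} {hsq : HasBiratSquares F} {P : Set C}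
  {X X' X'' : C}

variable (hF hsq) in
/-- The conjugated birational morphism of `φ : X → X'` with respect to `F_P`-paths `p`, `p'`:
`ζ_{A'}^birat ∘ (ζ_{X'}^birat)⁻¹ ∘ φ^birat ∘ ζ_X^birat ∘ (ζ_A^birat)⁻¹ : A^birat → A'^birat`.
[cite: MochizukiFrdI2008, Thm. 5.2(iv) p.102] -/
noncomputable def pathHom (p : FPPath F P X) (p' : FPPath F P X') (φ : X ⟶ X') :
    (toBirat F hF hsq).obj p.A ⟶ (toBirat F hF hsq).obj p'.A :=
  haveI := Birat.isIso_toBirat_map (hF := hF) (hsq := hsq) p.ζA p.ζA_mem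
  haveI := Birat.isIso_toBirat_map (hF := hF) (hsq := hsq) p'.ζX p'.ζX_mem
  inv ((toBirat F hF hsq).map p.ζA) ≫ (toBirat F hF hsq).map p.ζX ≫ (toBirat F hF hsq).map φ ≫
    inv ((toBirat F hF hsq).map p'.ζX) ≫ (toBirat F hF hsq).map p'.ζA

/-- Functoriality: `pathHom (φ ≫ φ') = pathHom φ ≫ pathHom φ'` (the inner path isomorphisms cancel).
[cite: MochizukiFrdI2008, Thm. 5.2(iv) p.102] -/
theorem pathHom_comp (p : FPPath F P X) (p' : FPPath F P X') (p'' : FPPath F P X'') (φ : X ⟶ X')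
    (φ' : X' ⟶ X'') :
    pathHom hF hsq p p'' (φ ≫ φ') = pathHom hF hsq p p' φ ≫ pathHom hF hsq p' p'' φ' := by
  haveI := Birat.isIso_toBirat_map (hF := hF) (hsq := hsq) p.ζA p.ζA_mem
  haveI := Birat.isIso_toBirat_map (hF := hF) (hsq := hsq) p'.ζA p'.ζA_mem
  haveI := Birat.isIso_toBirat_map (hF := hF) (hsq := hsq) p'.ζX p'.ζX_mem
  haveI := Birat.isIso_toBirat_map (hF := hF) (hsq := hsq) p''.ζX p''.ζX_mem
  unfold pathHom
  simp only [Functor.map_comp, Category.assoc, IsIso.hom_inv_id_assoc, IsIso.inv_hom_id_assoc]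

/-- Functoriality: `pathHom (𝟙 X) = 𝟙` for one and the same path.
[cite: MochizukiFrdI2008, Thm. 5.2(iv) p.102] -/
theorem pathHom_id (p : FPPath F P X) : pathHom hF hsq p p (𝟙 X) = 𝟙 _ := by
  haveI := Birat.isIso_toBirat_map (hF := hF) (hsq := hsq) p.ζA p.ζA_mem
  haveI := Birat.isIso_toBirat_map (hF := hF) (hsq := hsq) p.ζX p.ζX_mem
  unfold pathHom
  simp only [CategoryTheory.Functor.map_id, Category.id_comp, IsIso.hom_inv_id_assoc,
    IsIso.inv_hom_id]

/-- Change of path at the source is an isomorphism: `pathHom_{p₂,p'} φ = pathHom_{p₂,p₁} (𝟙) ≫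
pathHom_{p₁,p'} φ`.
[cite: MochizukiFrdI2008, Thm. 5.2(iv) p.102] -/
theorem pathHom_change (p₁ p₂ : FPPath F P X) (p' : FPPath F P X') (φ : X ⟶ X') :
    pathHom hF hsq p₂ p' φ = pathHom hF hsq p₂ p₁ (𝟙 X) ≫ pathHom hF hsq p₁ p' φ := by
  rw [← pathHom_comp, Category.id_comp]

/-- The base map of `pathHom φ` is `Base(ζ_{A'}) ∘ Base(ζ_{X'})⁻¹ ∘ Base(φ) ∘ Base(ζ_X) ∘
Base(ζ_A)⁻¹`
(the second entry of the comparison functor, p. 102). [cite: MochizukiFrdI2008, Thm. 5.2(iv) p.102]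
-/
theorem base_pathHom (p : FPPath F P X) (p' : FPPath F P X') (φ : X ⟶ X') :
    haveI : IsIso (Base F p.ζA) := p.ζA_mem.2.2
    haveI : IsIso (Base F p'.ζX) := p'.ζX_mem.2.2
    Base (Birat.toElemGp hF hsq) (pathHom hF hsq p p' φ) =
      inv (Base F p.ζA) ≫ Base F p.ζX ≫ Base F φ ≫ inv (Base F p'.ζX) ≫ Base F p'.ζA := by
  haveI : IsIso (Base F p.ζA) := p.ζA_mem.2.2
  haveI : IsIso (Base F p'.ζX) := p'.ζX_mem.2.2
  haveI := Birat.isIso_toBirat_map (hF := hF) (hsq := hsq) p.ζA p.ζA_mem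
  haveI := Birat.isIso_toBirat_map (hF := hF) (hsq := hsq) p'.ζX p'.ζX_mem
  have hb : ∀ {Y Z : C} (ψ : Y ⟶ Z),
      Base (Birat.toElemGp hF hsq) ((toBirat F hF hsq).map ψ) = Base F ψ :=
    fun ψ => Birat.base_toBirat_map ψ
  have hA : Base (Birat.toElemGp hF hsq) ((toBirat F hF hsq).map p.ζA ≫
      inv ((toBirat F hF hsq).map p.ζA)) = 𝟙 _ := by
    rw [IsIso.hom_inv_id, base_id]
  rw [base_comp, hb] at hA
  have hinvA : Base (Birat.toElemGp hF hsq) (inv ((toBirat F hF hsq).map p.ζA)) =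
      inv (Base F p.ζA) :=
    @IsIso.eq_inv_of_hom_inv_id D _ _ _ (Base F p.ζA) p.ζA_mem.2.2 _ hA
  have hX : Base (Birat.toElemGp hF hsq) ((toBirat F hF hsq).map p'.ζX ≫
      inv ((toBirat F hF hsq).map p'.ζX)) = 𝟙 _ := by
    rw [IsIso.hom_inv_id, base_id]
  rw [base_comp, hb] at hX
  have hinvX : Base (Birat.toElemGp hF hsq) (inv ((toBirat F hF hsq).map p'.ζX)) =
      inv (Base F p'.ζX) :=
    @IsIso.eq_inv_of_hom_inv_id D _ _ _ (Base F p'.ζX) p'.ζX_mem.2.2 _ hX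
  unfold pathHom
  rw [base_comp, base_comp, base_comp, base_comp, hinvA, hb, hb, hinvX, hb]
  rfl

/-- The Frobenius degree of `pathHom φ` is `deg_Fr(φ)` (the first entry of the comparison functor).
[cite: MochizukiFrdI2008, Thm. 5.2(iv) p.102] -/
theorem degFr_pathHom (p : FPPath F P X) (p' : FPPath F P X') (φ : X ⟶ X') :
    degFr (Birat.toElemGp hF hsq) (pathHom hF hsq p p' φ) = degFr F φ := by
  haveI := Birat.isIso_toBirat_map (hF := hF) (hsq := hsq) p.ζA p.ζA_mem
  haveI := Birat.isIso_toBirat_map (hF := hF) (hsq := hsq) p'.ζX p'.ζX_mem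
  have hd : ∀ {Y Z : C} (ψ : Y ⟶ Z),
      degFr (Birat.toElemGp hF hsq) ((toBirat F hF hsq).map ψ) = degFr F ψ :=
    fun ψ => Birat.degFr_toBirat_map ψ
  have hinv : ∀ {Y Z : C} (ψ : Y ⟶ Z) (hψ : IsCoAngularPreStep F ψ),
      haveI := Birat.isIso_toBirat_map (hF := hF) (hsq := hsq) ψ hψ
      degFr (Birat.toElemGp hF hsq) (inv ((toBirat F hF hsq).map ψ)) = 1 := fun ψ hψ => by
    haveI := Birat.isIso_toBirat_map (hF := hF) (hsq := hsq) ψ hψ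
    have h := degFr_comp (Birat.toElemGp hF hsq) (inv ((toBirat F hF hsq).map ψ))
      ((toBirat F hF hsq).map ψ)
    rw [IsIso.inv_hom_id, degFr_id, hd, hψ.2.1, mul_one] at h
    exact h.symm
  unfold pathHom
  rw [degFr_comp, degFr_comp, degFr_comp, degFr_comp, hinv p.ζA p.ζA_mem, hd, p.ζX_mem.2.1, hd,
    hinv p'.ζX p'.ζX_mem, hd, p'.ζA_mem.2.1, one_mul, one_mul, mul_one, mul_one]

end FPPath

end PreFrobenioid

end Literature.AlgebraicGeometry.Frobenioids
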